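import Summits.AnomalousDissipation.AnomalousDissipation.Theorems.MomentLadder.Negative.Clauses
import Summits.AnomalousDissipation.AnomalousDissipation.Theorems.CubicParityLoud.Negative.MeanFlow

/-!
# Negative knowledge for the crux `MomentParity.MomentLadder` (stmt-AnomalousDissipation-11463):
# II — energy row at order `d ≥ 3`: dissipation = injection; force / radius / mean-flow / laminar floors

Certified copy of sections C, F, G of `Cruxes/MomentLadder/Disproof.lean`
(refuter-cdisprove-stmt-AnomalousDissipation-11463-0, cycle 1). Supports stmt-AnomalousDissipation-11463; no
positive route-item statement is asserted. The analytic core (energy row of a polynomially 3-stationary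
level-`N` law) is the landed sibling file `Theorems/QuarticGate/Negative/EnergyRow.lean` (itself resting on
`Theorems/CubicParityLoud/Negative/EnergyRow.lean`); the laminar ceiling is the sibling's `IsWitness.laminar`
(`Theorems/CubicParityLoud/Negative/MeanFlow.lean`).

* `IsLadderWitness.dissipation_eq` — `ensembleDissipation ν μ = ∫ (u, f) dμ` for witnesses of order `≥ 3`.
* `IsLadderWitness.eps_le_force` (`ε ≤ ‖f‖₂ √E`), `IsLadderWitness.eps_le_force_mul_radius` (`ε ≤ ‖f‖₂ R`),
  `IsLadderWitness.force_not_ae_zero`.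
* `not_momentLadderEveryForce` — the `∀ f` strengthening is FALSE; `not_momentLadderSubFloor` — `‖f‖₂√E < ε`
  is FALSE (tight: the laminar Kolmogorov Dirac of `Theorems/QuarticGate/Negative/Laminar.lean`).
* MEAN FLOW: `meanState μ = ∫ u dμ ∈ H` (Bochner; `H` is complete and second countable),
  `integral_pairing_eq_pairing_meanState`, `IsLadderWitness.dissipation_eq_pairing_meanState`
  (`ν∫‖∇u‖² dμ = (ū, f)`), `IsLadderWitness.meanFlow_floor` (`ε ≤ (ū, f) ≤ ‖f‖₂‖ū‖`, `‖ū‖ ≤ √E`),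
  `IsLadderWitness.meanState_ne_zero`, `not_momentLadderZeroMeanFlow` — no zero-mean (symmetric,
  isotropic, Gibbs-equilibrium) family witnesses the ladder.
* LAMINAR CEILING: `IsLadderWitness.isCubicWitness`, `IsLadderWitness.eps_le_laminar` (`ε ≤ ‖f‖₂²/(4π²ν)`),
  `not_momentLadderBudgetsBeforeViscosities` — budgets chosen before the viscosity sequence is FALSE.
-/

namespace Summit.AnomalousDissipation.AnomalousDissipation.Theorems.MomentLadder.Negative

open MeasureTheory Filter Topology
open scoped ENNReal InnerProductSpace RealInnerProductSpace
open Literature.Analysis.FunctionSpaces Literature.Analysis.FluidPDE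
open Summit.AnomalousDissipation.AnomalousDissipation.Theses.MomentParity
open Summit.AnomalousDissipation.AnomalousDissipation.Theorems.QuarticGate.Negative

noncomputable section

/-! ## C. Energy row (order `d ≥ 3`): dissipation = injection; force floor, radius floor -/

section EnergyRow

/-- **Dissipation = mean injection** for a ladder witness of order `d ≥ 3` with an `L²` force:
`ensembleDissipation ν μ = ∫ (u, f) dμ` (the quadratic frame test, landed sibling energy row). [folklore] -/
theorem IsLadderWitness.dissipation_eq {f : UnitAddTorus (Fin 3) → EuclideanSpace ℝ (Fin 3)}
    (hf : MemLp f 2 volume) {ν : ℝ} {N : ℕ} {E ε R : ℝ} {κ : ℕ → ℕ} {d : ℕ}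
    {μ : Measure (Torus.energySpace (Fin 3))} (h : IsLadderWitness f ν N E ε R κ d μ) (hd : 3 ≤ d) :
    Torus.ensembleDissipation ν μ = ∫ u, Torus.pairing u.1 f ∂μ := by
  obtain ⟨hprob, hlev, hsupp, -, hstat, -, -⟩ := h
  exact ensembleDissipation_eq_of_polyStationary f hf hlev (integrable_norm_pow_of_isSupported hsupp 2)
    hd hstat

/-- **FORCE FLOOR**: `ε ≤ ‖f‖_{L²} √E` for every ladder witness of order `d ≥ 3`. [folklore] -/
theorem IsLadderWitness.eps_le_force {f : UnitAddTorus (Fin 3) → EuclideanSpace ℝ (Fin 3)}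
    (hf : MemLp f 2 volume) {ν : ℝ} {N : ℕ} {E ε R : ℝ} {κ : ℕ → ℕ} {d : ℕ}
    {μ : Measure (Torus.energySpace (Fin 3))} (h : IsLadderWitness f ν N E ε R κ d μ) (hd : 3 ≤ d) :
    ε ≤ Real.sqrt (∫ x, ‖f x‖ ^ 2) * Real.sqrt E := by
  obtain ⟨hprob, hlev, hsupp, -, hstat, hEn, hε⟩ := h
  calc ε ≤ Torus.ensembleDissipation ν μ := hε
    _ ≤ Real.sqrt (∫ x, ‖f x‖ ^ 2) * Real.sqrt (Torus.ensembleEnergy μ) :=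
        ensembleDissipation_le_of_polyStationary f hf hlev (integrable_norm_pow_of_isSupported hsupp 2)
          hd hstat
    _ ≤ Real.sqrt (∫ x, ‖f x‖ ^ 2) * Real.sqrt E := by gcongr

/-- **RADIUS FLOOR**: `ε ≤ ‖f‖_{L²} R` for every ladder witness of order `d ≥ 3` — the support radius
of a witnessing family cannot shrink below `ε/‖f‖₂` (uniformly in `j`). [folklore] -/
theorem IsLadderWitness.eps_le_force_mul_radius {f : UnitAddTorus (Fin 3) → EuclideanSpace ℝ (Fin 3)}
    (hf : MemLp f 2 volume) {ν : ℝ} {N : ℕ} {E ε R : ℝ} {κ : ℕ → ℕ} {d : ℕ}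
    {μ : Measure (Torus.energySpace (Fin 3))} (h : IsLadderWitness f ν N E ε R κ d μ) (hd : 3 ≤ d) :
    ε ≤ Real.sqrt (∫ x, ‖f x‖ ^ 2) * R := by
  have hdiss := h.dissipation_eq hf hd
  obtain ⟨hprob, hlev, hsupp, -, hstat, hEn, hε⟩ := h
  have h1 : Integrable (fun u : Torus.energySpace (Fin 3) => ‖u‖) μ := by
    simpa using integrable_norm_pow_of_isSupported hsupp 1
  have hle : ∫ u, Torus.pairing u.1 f ∂μ ≤ ∫ _u, ‖hf.toLp f‖ * R ∂μ :=
    integral_mono_ae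
      (Summit.AnomalousDissipation.AnomalousDissipation.Theorems.CubicParityLoud.Negative.integrable_pairing
        hf h1) (integrable_const _)
      (Filter.Eventually.mono hsupp fun u hu => (le_abs_self _).trans
        ((Torus.abs_pairing_coe_le hf u).trans (by
          rw [mul_comm]; exact mul_le_mul_of_nonneg_left hu (norm_nonneg _))))
  have hconst : ∫ _u, ‖hf.toLp f‖ * R ∂μ = ‖hf.toLp f‖ * R := by simp
  rw [hconst, Torus.norm_toLp_eq_sqrt hf] at hle
  linarith [hdiss ▸ hε]

/-- A witness force is not `0` (in `L²`): at order `d ≥ 3`, `f = 0` a.e. forces `ε ≤ 0`. [folklore] -/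
theorem IsLadderWitness.force_not_ae_zero {f : UnitAddTorus (Fin 3) → EuclideanSpace ℝ (Fin 3)}
    (hf : MemLp f 2 volume) {ν : ℝ} {N : ℕ} {E ε R : ℝ} (hε : 0 < ε) {κ : ℕ → ℕ} {d : ℕ}
    {μ : Measure (Torus.energySpace (Fin 3))} (h : IsLadderWitness f ν N E ε R κ d μ) (hd : 3 ≤ d) :
    ¬ (f =ᵐ[volume] 0) := fun h0 => by
  have h1 := h.eps_le_force hf hd
  have h2 : ∫ x, ‖f x‖ ^ 2 = 0 := by
    rw [integral_congr_ae (g := fun _ => (0 : ℝ)) (h0.mono fun x hx => by simp [hx])]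
    simp
  rw [h2, Real.sqrt_zero, zero_mul] at h1
  linarith

/-- NATURAL STRENGTHENING 3 (refuted): `MomentLadder` for EVERY admissible force. -/
def MomentLadderEveryForce : Prop :=
  ∀ f : UnitAddTorus (Fin 3) → EuclideanSpace ℝ (Fin 3),
    Torus.IsSmooth f → Torus.IsDivFree f → Torus.HasZeroMean f →
    ∃ (ν : ℕ → ℝ) (E ε : ℝ), (∀ j, 0 < ν j) ∧ Tendsto ν atTop (𝓝 0) ∧ 0 < ε ∧
    ∀ j : ℕ, ∃ (R : ℝ) (κ : ℕ → ℕ), ∃ᶠ N in atTop, ∀ d : ℕ, ∃ μ,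
      IsLadderWitness f (ν j) N E ε R κ d μ

/-- **`¬ MomentLadderEveryForce`**: the zero force is quiet at every order (`ε ≤ ‖0‖₂ √E = 0`).
The `∃ f` of the crux is load-bearing; a witness force has `‖f‖_{L²} ≥ ε/√E` and `≥ ε/R`. [folklore] -/
theorem not_momentLadderEveryForce : ¬ MomentLadderEveryForce := by
  intro h
  have hzero : (Torus.realTrigPoly (∅ : Finset (Fin 3 → ℤ)) (0 : (Fin 3 → ℤ) → EuclideanSpace ℂ (Fin 3)))
      = fun _ => 0 := Torus.realTrigPoly_zero ∅
  obtain ⟨ν, E, ε, hν, -, hε, hj⟩ := h (fun _ => 0) (Torus.isSmooth_const _)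
    (by rw [← hzero]; exact Torus.isDivFree_realTrigPoly fun k hk => by simp at hk)
    (by simp [Torus.HasZeroMean])
  obtain ⟨R, κ, hfreq⟩ := hj 0
  obtain ⟨N, hN⟩ := hfreq.exists
  obtain ⟨μ, hμ⟩ := hN 3
  have := hμ.eps_le_force (memLp_const 0) le_rfl
  simp at this
  linarith

/-- NATURAL STRENGTHENING 4 (refuted): `MomentLadder` with an energy budget below the force floor,
`‖f‖_{L²} √E < ε`. -/
def MomentLadderSubFloor : Prop :=
  ∃ f : UnitAddTorus (Fin 3) → EuclideanSpace ℝ (Fin 3),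
    Torus.IsSmooth f ∧ Torus.IsDivFree f ∧ Torus.HasZeroMean f ∧
    ∃ (ν : ℕ → ℝ) (E ε : ℝ), (∀ j, 0 < ν j) ∧ Tendsto ν atTop (𝓝 0) ∧ 0 < ε ∧
    Real.sqrt (∫ x, ‖f x‖ ^ 2) * Real.sqrt E < ε ∧
    ∀ j : ℕ, ∃ (R : ℝ) (κ : ℕ → ℕ), ∃ᶠ N in atTop, ∀ d : ℕ, ∃ μ,
      IsLadderWitness f (ν j) N E ε R κ d μ

/-- **`¬ MomentLadderSubFloor`**: `ε ≤ ‖f‖_{L²}√E` for every witness of order `≥ 3`; TIGHT (the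
laminar Kolmogorov Dirac of `Negative/Laminar.lean` attains it). Provers: `E ≥ (ε/‖f‖₂)²`. [folklore] -/
theorem not_momentLadderSubFloor : ¬ MomentLadderSubFloor := by
  rintro ⟨f, hfs, -, -, ν, E, ε, hν, -, hε, hlt, hj⟩
  obtain ⟨R, κ, hfreq⟩ := hj 0
  obtain ⟨N, hN⟩ := hfreq.exists
  obtain ⟨μ, hμ⟩ := hN 3
  have := hμ.eps_le_force (hfs.memLp 2) le_rfl
  linarith

end EnergyRow

/-! ## F. Mean flow: every witness has a mean flow `ū` with `(ū, f) ≥ ε`, `‖ū‖ ≥ ε/‖f‖₂` -/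

section MeanFlow

/-- `H = L²_σ(T³)` is complete (a closed subspace of `L²(T³; ℝ³)`). [folklore] -/
instance instCompleteSpaceEnergySpace : CompleteSpace (Torus.energySpace (Fin 3)) :=
  (Torus.isClosed_energySpace (d := Fin 3)).completeSpace_coe

/-- `2 ≠ ∞` as a `Fact` (the exponent hypothesis of Mathlib's `Lp.SecondCountableTopology`). [folklore] -/
instance instFactTwoNeTop : Fact ((2 : ℝ≥0∞) ≠ ∞) := ⟨ENNReal.ofNat_ne_top⟩

/-- `H = L²_σ(T³)` is second countable (a subspace of the separable `L²(T³; ℝ³)`,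
Mathlib's `Lp.SecondCountableTopology`). [folklore] -/
instance instSecondCountableTopologyEnergySpace : SecondCountableTopology (Torus.energySpace (Fin 3)) :=
  TopologicalSpace.Subtype.secondCountableTopology _

/-- The MEAN FLOW `ū = ∫ u dμ ∈ H` of a law on the energy space (Bochner integral in `H`). -/
def meanState (μ : Measure (Torus.energySpace (Fin 3))) : Torus.energySpace (Fin 3) :=
  ∫ u, u ∂μ

/-- The pairing with an `L²` field is a continuous linear functional on `H`. [folklore] -/
theorem pairing_eq_clm {f : UnitAddTorus (Fin 3) → EuclideanSpace ℝ (Fin 3)} (hf : MemLp f 2 volume)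
    (u : Torus.energySpace (Fin 3)) :
    Torus.pairing u.1 f =
      ((innerSL ℝ (hf.toLp f)).comp (Torus.energySpace (Fin 3)).subtypeL) u := by
  rw [ContinuousLinearMap.comp_apply, Submodule.subtypeL_apply, innerSL_apply_apply,
    real_inner_comm, Torus.pairing_eq_inner hf]

/-- **Mean injection = injection into the mean flow**: `∫ (u, f) dμ = (ū, f)` when `u` is Bochner
integrable. [folklore] -/
theorem integral_pairing_eq_pairing_meanState {f : UnitAddTorus (Fin 3) → EuclideanSpace ℝ (Fin 3)}
    (hf : MemLp f 2 volume) {μ : Measure (Torus.energySpace (Fin 3))}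
    (h1 : Integrable (fun u : Torus.energySpace (Fin 3) => u) μ) :
    ∫ u, Torus.pairing u.1 f ∂μ = Torus.pairing (meanState μ).1 f := by
  simp_rw [pairing_eq_clm hf]
  rw [ContinuousLinearMap.integral_comp_comm _ h1]
  rfl

/-- Jensen for the mean flow: `‖ū‖ ≤ √(ensembleEnergy μ)` on a probability law with integrable
energy. [folklore] -/
theorem norm_meanState_le {μ : Measure (Torus.energySpace (Fin 3))} [IsProbabilityMeasure μ]
    (h2 : Integrable (fun u : Torus.energySpace (Fin 3) => ‖u‖ ^ 2) μ) :
    ‖meanState μ‖ ≤ Real.sqrt (Torus.ensembleEnergy μ) := by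
  have hsq := Summit.AnomalousDissipation.AnomalousDissipation.Theorems.CubicParityLoud.Negative.sq_integral_norm_le h2
  calc ‖meanState μ‖ ≤ ∫ u, ‖u‖ ∂μ := norm_integral_le_integral_norm _
    _ ≤ Real.sqrt (∫ u, ‖u‖ ^ 2 ∂μ) := Real.le_sqrt_of_sq_le hsq
    _ = Real.sqrt (Torus.ensembleEnergy μ) := rfl

/-- A supported law has a Bochner-integrable identity. [folklore] -/
theorem integrable_id_of_isSupported {μ : Measure (Torus.energySpace (Fin 3))} [IsFiniteMeasure μ]
    {R : ℝ} (hR : IsSupported R μ) : Integrable (fun u : Torus.energySpace (Fin 3) => u) μ :=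
  Integrable.mono' (integrable_const (max R 0)) continuous_id.aestronglyMeasurable
    (Filter.Eventually.mono hR fun _ hu => hu.trans (le_max_left _ _))

/-- **Dissipation = injection into the mean flow** for a ladder witness of order `≥ 3`:
`ensembleDissipation ν μ = (ū, f)`. [folklore] -/
theorem IsLadderWitness.dissipation_eq_pairing_meanState {f : UnitAddTorus (Fin 3) → EuclideanSpace ℝ (Fin 3)}
    (hf : MemLp f 2 volume) {ν : ℝ} {N : ℕ} {E ε R : ℝ} {κ : ℕ → ℕ} {d : ℕ}
    {μ : Measure (Torus.energySpace (Fin 3))} (h : IsLadderWitness f ν N E ε R κ d μ) (hd : 3 ≤ d) :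
    Torus.ensembleDissipation ν μ = Torus.pairing (meanState μ).1 f := by
  have h1 := h.dissipation_eq hf hd
  obtain ⟨hprob, -, hsupp, -, -, -, -⟩ := h
  rw [h1, integral_pairing_eq_pairing_meanState hf (integrable_id_of_isSupported hsupp)]

/-- **MEAN-FLOW FLOOR**: `ε ≤ (ū, f) ≤ ‖f‖₂ ‖ū‖` and `‖ū‖ ≤ √E` for every ladder witness of order
`≥ 3`: the mean flow is non-zero, of norm `≥ ε/‖f‖₂`, and positively correlated with the force. [folklore] -/
theorem IsLadderWitness.meanFlow_floor {f : UnitAddTorus (Fin 3) → EuclideanSpace ℝ (Fin 3)}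
    (hf : MemLp f 2 volume) {ν : ℝ} {N : ℕ} {E ε R : ℝ} {κ : ℕ → ℕ} {d : ℕ}
    {μ : Measure (Torus.energySpace (Fin 3))} (h : IsLadderWitness f ν N E ε R κ d μ) (hd : 3 ≤ d) :
    ε ≤ Torus.pairing (meanState μ).1 f ∧
      Torus.pairing (meanState μ).1 f ≤ Real.sqrt (∫ x, ‖f x‖ ^ 2) * ‖meanState μ‖ ∧
      ‖meanState μ‖ ≤ Real.sqrt E := by
  have h1 := h.dissipation_eq_pairing_meanState hf hd
  obtain ⟨hprob, -, hsupp, -, -, hEn, hε⟩ := h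
  refine ⟨h1 ▸ hε, ?_, ?_⟩
  · have := (le_abs_self _).trans (Torus.abs_pairing_coe_le hf (meanState μ))
    rwa [Torus.norm_toLp_eq_sqrt hf, mul_comm] at this
  · exact (norm_meanState_le (integrable_norm_pow_of_isSupported hsupp 2)).trans (Real.sqrt_le_sqrt hEn)

/-- A witness of order `≥ 3` with `ε > 0` has a non-zero mean flow. [folklore] -/
theorem IsLadderWitness.meanState_ne_zero {f : UnitAddTorus (Fin 3) → EuclideanSpace ℝ (Fin 3)}
    (hf : MemLp f 2 volume) {ν : ℝ} {N : ℕ} {E ε R : ℝ} (hε : 0 < ε) {κ : ℕ → ℕ} {d : ℕ}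
    {μ : Measure (Torus.energySpace (Fin 3))} (h : IsLadderWitness f ν N E ε R κ d μ) (hd : 3 ≤ d) :
    meanState μ ≠ 0 := fun h0 => by
  obtain ⟨h1, h2, -⟩ := h.meanFlow_floor hf hd
  rw [h0] at h1 h2
  rw [norm_zero, mul_zero] at h2
  linarith

/-- NATURAL STRENGTHENING 5 (refuted): a witnessing family with ZERO MEAN FLOW (e.g. laws symmetric
under `u ↦ −u`, isotropic ensembles, Gibbs-type equilibria of truncated Euler). -/
def MomentLadderZeroMeanFlow : Prop :=
  ∃ f : UnitAddTorus (Fin 3) → EuclideanSpace ℝ (Fin 3),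
    Torus.IsSmooth f ∧ Torus.IsDivFree f ∧ Torus.HasZeroMean f ∧
    ∃ (ν : ℕ → ℝ) (E ε : ℝ), (∀ j, 0 < ν j) ∧ Tendsto ν atTop (𝓝 0) ∧ 0 < ε ∧
    ∀ j : ℕ, ∃ (R : ℝ) (κ : ℕ → ℕ), ∃ᶠ N in atTop, ∀ d : ℕ, ∃ μ,
      IsLadderWitness f (ν j) N E ε R κ d μ ∧ meanState μ = 0

/-- **`¬ MomentLadderZeroMeanFlow`**: loudness IS mean-flow/force correlation (`ε ≤ (ū, f)`), so no
symmetric or isotropic ensemble — in particular no absolute-equilibrium (Gibbs) ensemble of truncated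
Euler, whose mean vanishes — can witness the ladder; the witness must carry a coherent mean flow of
size `≥ ε/‖f‖₂` at energy `≤ E`, uniformly as `ν_j → 0`. [folklore] -/
theorem not_momentLadderZeroMeanFlow : ¬ MomentLadderZeroMeanFlow := by
  rintro ⟨f, hfs, -, -, ν, E, ε, hν, -, hε, hj⟩
  obtain ⟨R, κ, hfreq⟩ := hj 0
  obtain ⟨N, hN⟩ := hfreq.exists
  obtain ⟨μ, hμ, h0⟩ := hN 3
  exact hμ.meanState_ne_zero (hfs.memLp 2) hε le_rfl h0

end MeanFlow

/-! ## G. Transfer to `CubicParityLoud`'s witness bundle: laminar (Poincaré) ceiling `ε ≤ ‖f‖₂²/(4π²ν_j)` -/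

section Laminar

/-- A ladder witness of order `d ≥ 3` is a witness of the sibling crux `CubicParityLoud` at `(f, ν, N)`
(third moments from the support clause, 3-stationarity from `d`-stationarity). [folklore] -/
theorem IsLadderWitness.isCubicWitness {f : UnitAddTorus (Fin 3) → EuclideanSpace ℝ (Fin 3)} {ν : ℝ}
    {N : ℕ} {E ε R : ℝ} {κ : ℕ → ℕ} {d : ℕ} {μ : Measure (Torus.energySpace (Fin 3))}
    (h : IsLadderWitness f ν N E ε R κ d μ) (hd : 3 ≤ d) :
    Summit.AnomalousDissipation.AnomalousDissipation.Theorems.CubicParityLoud.Negative.IsWitness f ν N E ε μ := by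
  obtain ⟨hprob, hlev, hsupp, -, hstat, hEn, hε⟩ := h
  exact ⟨hprob, hlev, integrable_norm_pow_of_isSupported hsupp 3, hstat.isStationary3 hd, hEn, hε⟩

/-- **LAMINAR (Poincaré) CEILING**: `ε ≤ ‖f‖₂² / (4π²ν)` for every ladder witness of order `≥ 3` with
`ε > 0` (energy row + Poincaré in the mean + Cauchy–Schwarz; landed as the sibling's `IsWitness.laminar`).
So the witnessing viscosities satisfy `ν_j ≤ ‖f‖₂²/(4π²ε)` for EVERY `j`: the budgets bound `sup_j ν_j`.
Tight: the laminar Kolmogorov Dirac attains it (`(8π²ν)⁻¹ = ‖K_1‖₂²/(4π²ν)`, `‖K_1‖₂² = 1/2`). [folklore] -/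
theorem IsLadderWitness.eps_le_laminar {f : UnitAddTorus (Fin 3) → EuclideanSpace ℝ (Fin 3)}
    (hf : MemLp f 2 volume) {ν : ℝ} (hν : 0 < ν) {N : ℕ} {E ε R : ℝ} (hε : 0 < ε) {κ : ℕ → ℕ} {d : ℕ}
    {μ : Measure (Torus.energySpace (Fin 3))} (h : IsLadderWitness f ν N E ε R κ d μ) (hd : 3 ≤ d) :
    ε ≤ (∫ x, ‖f x‖ ^ 2) / (4 * Real.pi ^ 2 * ν) :=
  Summit.AnomalousDissipation.AnomalousDissipation.Theorems.CubicParityLoud.Negative.IsWitness.laminar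
    hf hν hε (h.isCubicWitness hd)

/-- NATURAL STRENGTHENING 6 (refuted): budgets `E`, `ε` depending on the force only — i.e. chosen BEFORE
the viscosity sequence, which is then arbitrary (`∃ f E ε ∀ ν`). -/
def MomentLadderBudgetsBeforeViscosities : Prop :=
  ∃ f : UnitAddTorus (Fin 3) → EuclideanSpace ℝ (Fin 3),
    Torus.IsSmooth f ∧ Torus.IsDivFree f ∧ Torus.HasZeroMean f ∧
    ∃ (E ε : ℝ), 0 < ε ∧ ∀ ν : ℕ → ℝ, (∀ j, 0 < ν j) → Tendsto ν atTop (𝓝 0) →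
    ∀ j : ℕ, ∃ (R : ℝ) (κ : ℕ → ℕ), ∃ᶠ N in atTop, ∀ d : ℕ, ∃ μ,
      IsLadderWitness f (ν j) N E ε R κ d μ

/-- **`¬ MomentLadderBudgetsBeforeViscosities`**: by the laminar ceiling no witness exists at a viscosity
`ν_j > ‖f‖₂²/(4π²ε)`, and a vanishing sequence may start anywhere (`ν_j = M/(j+1)`). Only the trivial
large-viscosity regime is involved; the information for provers is the quantitative one, `sup_j ν_j ≤
‖f‖₂²/(4π²ε)` (together with `E ≥ (ε/‖f‖₂)²`, `N_j, κ_j(0) ≳ ν_j^{-1/2}`). [folklore] -/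
theorem not_momentLadderBudgetsBeforeViscosities : ¬ MomentLadderBudgetsBeforeViscosities := by
  rintro ⟨f, hfs, -, -, E, ε, hε, hall⟩
  set A2 : ℝ := ∫ x, ‖f x‖ ^ 2 with hA2
  have hA0 : 0 ≤ A2 := integral_nonneg fun _ => by positivity
  set M : ℝ := (A2 + 1) / (2 * Real.pi ^ 2 * ε) with hM
  have hMpos : 0 < M := by positivity
  have hν : ∀ j : ℕ, 0 < M / ((j : ℝ) + 1) := fun j => by positivity
  have hν0 : Tendsto (fun j : ℕ => M / ((j : ℝ) + 1)) atTop (𝓝 0) := by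
    have h := tendsto_one_div_add_atTop_nhds_zero_nat.const_mul M
    rw [mul_zero] at h
    refine h.congr fun j => ?_
    rw [mul_one_div]
  obtain ⟨R, κ, hfreq⟩ := hall (fun j => M / ((j : ℝ) + 1)) hν hν0 0
  obtain ⟨N, hN⟩ := hfreq.exists
  obtain ⟨μ, hμ⟩ := hN 3
  have hlam := hμ.eps_le_laminar (hfs.memLp 2) (hν 0) hε le_rfl
  simp only [Nat.cast_zero, zero_add, div_one] at hlam
  have hden : 0 < 4 * Real.pi ^ 2 * M := by positivity
  rw [← hA2, le_div_iff₀ hden] at hlam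
  have : ε * (4 * Real.pi ^ 2 * M) = 2 * (A2 + 1) := by
    rw [hM]
    field_simp
    ring
  linarith

end Laminar

end

end Summit.AnomalousDissipation.AnomalousDissipation.Theorems.MomentLadder.Negative
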